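import Summits.RiemannHypothesis.RiemannHypothesis.Theorems.ThetaTier2Harm
import Mathlib.Analysis.SpecialFunctions.Exp
import HarnessLib

/-!
# THETA tier-2 kernel checker — the E1 cell majorants `S(t)`, `S₁(t)` and the envelope product (cc-s2-1, WEIL typing lane; RH-FREE)

(K1), second half, pointwise form (HOME/cc-s2-1/gen22/TIER2-KERNEL-SPEC.md §2/§5/§6(a)): the REAL finite-`K` majorants of THETA-CERT-cc6 E1,

  `Sfun θ₀ R m K t  = Σ_{k=1}^{K} |sin(kθ₀e^t)|^m k^{−(m+1)} + R`,
  `S1fun θ₀ c₂ ε Rm m K t = Σ_{k=1}^{K} (c₂|sin kθ₀e^t|^m + ε|sin kθ₀e^t|^{m−1}(1 + (θ₀e^t)⁻¹/k)) k^{−m} + Rm·(c₂ + ε(1 + (θ₀e^t)⁻¹/(K+1)))`,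

are dominated at every `t` with `θ₀e^t ∈ [val lo, val hi]` by the checker's cell values `S_j = (harm …).1 + residm1`, `S1_j = (harm …).2 + mulU residm (…)`
(`Sfun_le_cell`, `S1fun_le_cell`, from `harm_sound`), and the envelope product `e^{−κt}·S(t)·c̄ ≤ val (mulU (mulU emh Sj) cj)` whenever
`e^{−κt} ≤ val emh`, `S(t) ≤ val Sj`, `0 ≤ c̄ ≤ val cj` (`envelope_le_mulU`) — the shape of `cellStep`'s `e_j`.  The loop invariant over `cellLoop`
(that cell `j`'s `lo/hi/emh/…` enclose `θ₀e^{jτ}`, `e^{−(m+½)jτ}`, …) is the next file.  Nothing here bears on the truth of RH.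
-/

set_option linter.dupNamespace false  -- the mandated namespace repeats `RiemannHypothesis`
set_option autoImplicit false

namespace Summit.RiemannHypothesis.RiemannHypothesis.Theorems.ThetaTier2

open Real Finset

/-- E1's finite-`K` majorant of `|Θ(u₁e^{−t})|/(M₀e^{−mt})`: `Σ_{k=1}^{K} |sin(kθ₀e^t)|^m/k^{m+1} + R` (`R ≥ ζ(m+1) − Σ_{k≤K}k^{−(m+1)}`).
[this cell, THETA-CERT-cc6 E1] -/
noncomputable def Sfun (θ₀ R : ℝ) (m K : ℕ) (t : ℝ) : ℝ :=
  (∑ k ∈ Ico 1 (K + 1), |sin (k * (θ₀ * exp t))| ^ m / (k : ℝ) ^ (m + 1)) + R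

/-- E1's finite-`K` majorant for the derivative, `S₁(t)` (`Rm ≥ ζ(m) − Σ_{k≤K}k^{−m}`). [this cell, THETA-CERT-cc6 E1] -/
noncomputable def S1fun (θ₀ c₂ ε Rm : ℝ) (m K : ℕ) (t : ℝ) : ℝ :=
  (∑ k ∈ Ico 1 (K + 1), (c₂ * |sin (k * (θ₀ * exp t))| ^ m + ε * |sin (k * (θ₀ * exp t))| ^ (m - 1) * (1 + (θ₀ * exp t)⁻¹ / k)) / (k : ℝ) ^ m)
    + Rm * (c₂ + ε * (1 + (θ₀ * exp t)⁻¹ / (K + 1)))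

/-- **`S(t) ≤ val S_j`** on the cell: with the base angle `θ₀e^t ∈ [val lo, val hi]` and `R ≤ val A.residm1`. [this cell, TIER2-KERNEL-SPEC §2 (E1)] -/
theorem Sfun_le_cell (A : Inp) {lo hi invlo : ℕ} (hπ : val A.piL ≤ π ∧ π ≤ val A.piH)
    (hw : val A.piH - val A.piL ≤ 1 / 2 ^ 30) (hm : 1 ≤ A.m) (hsz : (A.K : ℝ) * val hi ≤ 2 ^ 24)
    {θ₀ R t : ℝ} (h1 : val lo ≤ θ₀ * exp t) (h2 : θ₀ * exp t ≤ val hi) (hR : R ≤ val A.residm1) :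
    Sfun θ₀ R A.m A.K t ≤ val ((harm A lo hi invlo A.K 0 0).1 + A.residm1) := by
  have h := (harm_sound A hπ hw hm hsz h1 h2 (le_refl (val A.c2)) (le_refl (val A.eps)) (val_nonneg invlo) le_rfl
    A.K le_rfl 0 0).1
  rw [val_zero, zero_add, show A.K + 1 - A.K = 1 by omega] at h
  unfold Sfun
  rw [val_add]
  linarith

/-- **`S₁(t) ≤ val S1_j`** on the cell (`ι = val invlo ≥ (θ₀e^t)⁻¹` is the kernel's `divU S lo`; any `0 ≤ c₂ ≤ val c2`, `0 ≤ ε ≤ val eps`, `Rm ≤ val residm`).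
[this cell, TIER2-KERNEL-SPEC §2 (E1)] -/
theorem S1fun_le_cell (A : Inp) {lo hi invlo : ℕ} (hπ : val A.piL ≤ π ∧ π ≤ val A.piH)
    (hw : val A.piH - val A.piL ≤ 1 / 2 ^ 30) (hm : 1 ≤ A.m) (hsz : (A.K : ℝ) * val hi ≤ 2 ^ 24)
    {θ₀ c₂ ε Rm t : ℝ} (h1 : val lo ≤ θ₀ * exp t) (h2 : θ₀ * exp t ≤ val hi) (hpos : 0 < θ₀ * exp t)
    (hc0 : 0 ≤ c₂) (hc : c₂ ≤ val A.c2) (he0 : 0 ≤ ε) (he : ε ≤ val A.eps) (hι : (θ₀ * exp t)⁻¹ ≤ val invlo)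
    (hRm : Rm ≤ val A.residm) :
    S1fun θ₀ c₂ ε Rm A.m A.K t ≤
      val ((harm A lo hi invlo A.K 0 0).2 + mulU A.residm (A.c2 + mulU A.eps (S + divUn invlo (A.K + 1)))) := by
  have hι0 : 0 ≤ (θ₀ * exp t)⁻¹ := inv_nonneg.2 hpos.le
  have h := (harm_sound A hπ hw hm hsz h1 h2 hc he hι0 hι A.K le_rfl 0 0).2
  rw [val_zero, zero_add, show A.K + 1 - A.K = 1 by omega] at h
  -- the residue term
  have hK1 : (0 : ℝ) < (A.K : ℝ) + 1 := by positivity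
  have hres : Rm * (c₂ + ε * (1 + (θ₀ * exp t)⁻¹ / (A.K + 1))) ≤
      val (mulU A.residm (A.c2 + mulU A.eps (S + divUn invlo (A.K + 1)))) := by
    have hi1 : 1 + (θ₀ * exp t)⁻¹ / (A.K + 1) ≤ val (S + divUn invlo (A.K + 1)) := by
      rw [val_add, val_S]
      have := le_divUn hι (show 0 < A.K + 1 by omega)
      push_cast at this
      linarith
    have hi2 : ε * (1 + (θ₀ * exp t)⁻¹ / (A.K + 1)) ≤ val (mulU A.eps (S + divUn invlo (A.K + 1))) :=
      le_mulU (by positivity) he hi1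
    have hi3 : c₂ + ε * (1 + (θ₀ * exp t)⁻¹ / (A.K + 1)) ≤ val (A.c2 + mulU A.eps (S + divUn invlo (A.K + 1))) := by
      rw [val_add]; linarith
    exact le_mulU (by positivity) hRm hi3
  unfold S1fun
  rw [val_add]
  linarith

/-- **The envelope product** (shape of `cellStep`'s `e_j := mulU (mulU emh Sj) cj`): `x·s·c ≤ val (mulU (mulU emh Sj) cj)` for
`x ≤ val emh`, `0 ≤ s ≤ val Sj`, `0 ≤ c ≤ val cj`. [this cell, TIER2-KERNEL-SPEC §2 (E3)] -/
theorem envelope_le_mulU {x s c : ℝ} {emh Sj cj : ℕ} (hx : x ≤ val emh) (hs0 : 0 ≤ s) (hs : s ≤ val Sj)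
    (hc0 : 0 ≤ c) (hc : c ≤ val cj) : x * s * c ≤ val (mulU (mulU emh Sj) cj) :=
  le_mulU hc0 (le_mulU hs0 hx hs) hc

/-- The decay factor is monotone on the cell: `t ≥ t₀ ⇒ e^{−κt} ≤ e^{−κt₀}` for `κ ≥ 0` — so the kernel may take the exponential at the LEFT end.
[folklore] -/
theorem exp_neg_mul_le_of_le {κ t t₀ : ℝ} (hκ : 0 ≤ κ) (h : t₀ ≤ t) : exp (-κ * t) ≤ exp (-κ * t₀) :=
  exp_le_exp.2 (by nlinarith)

/-- The base angle is monotone on the cell: `jτ ≤ t ≤ (j+1)τ ⇒ θ₀e^{jτ} ≤ θ₀e^t ≤ θ₀e^{(j+1)τ}` for `θ₀ ≥ 0` — so `[lo_j, hi_{j+1}]` encloses it.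
[folklore] -/
theorem base_angle_mem {θ₀ t a b : ℝ} (hθ : 0 ≤ θ₀) (ha : a ≤ t) (hb : t ≤ b) :
    θ₀ * exp a ≤ θ₀ * exp t ∧ θ₀ * exp t ≤ θ₀ * exp b :=
  ⟨mul_le_mul_of_nonneg_left (exp_le_exp.2 ha) hθ, mul_le_mul_of_nonneg_left (exp_le_exp.2 hb) hθ⟩

end Summit.RiemannHypothesis.RiemannHypothesis.Theorems.ThetaTier2
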